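import Mathlib
import HarnessLib
import Literature.MathematicalPhysics.QuantumLattice.KohnLuttinger
import Summits.HubbardSuperconductivity.HubbardSuperconductivity.Theorems.ChiralWindowCwChannelInfContinuousChemicalPotential

/-!
# Crux `CwKLChiralWindow` (stmt-HubbardSuperconductivity-1741), line `Sketch`: stub `stub_klWindowBridge`

The window bridge between chemical potentials and hole dopings for the nearest-neighbour band
`ε₀ = squareDispersion 1 0`.  Write `n = KohnLuttinger.filling ε₀` (continuous, monotone, strictly
increasing on the band `[-4, 4]`, `n(-4) = 0`) and `μ(m) = chemicalPotentialOfDensity ε₀ m`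
(`= sInf {μ | m ≤ n(μ)}`).  For `-4 < μ_b < μ_a < 0` and `a := 1 - n(μ_a)`, `b := 1 - n(μ_b)`:

* `a < b` (strict monotonicity);
* `μ(1 - a) = μ_a`, `μ(1 - b) = μ_b` (`chemicalPotentialOfDensity_eq_of_filling_eq`, using
  `0 = n(-4) < n(μ_b) < n(μ_a)`);
* for `δ ∈ [a, b]` the density `1 - δ ∈ [n(μ_b), n(μ_a)]` is attained at some `m ∈ [μ_b, μ_a]`
  (intermediate value theorem), whence `μ(1 - δ) = m ∈ [μ_b, μ_a]` and `n(μ(1 - δ)) = 1 - δ`.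

Folklore; no definitions.
-/

noncomputable section

set_option linter.dupNamespace false

namespace Summit.HubbardSuperconductivity.HubbardSuperconductivity.Theorems

open MeasureTheory Literature.MathematicalPhysics.QuantumLattice

/-- The filling of the free band is positive strictly above the band bottom (inside the band):
`0 = n(-4) < n(μ)` for `-4 < μ ≤ 4`. [folklore] -/
theorem kl_wb_filling_pos {μ : ℝ} (h4 : -4 < μ) (hμ : μ ≤ 4) :
    0 < KohnLuttinger.filling (squareDispersion 1 0) μ := by
  have h := strictMonoOn_filling ⟨le_rfl, by norm_num⟩ ⟨h4.le, hμ⟩ h4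
  rwa [filling_of_le_neg_four le_rfl] at h

/-- Inside the band the chemical potential of the density `n(μ)` is `μ` itself:
`μ(1 - (1 - n(μ))) = μ` for `-4 < μ ≤ 4`. [folklore] -/
theorem kl_wb_chemicalPotential_one_sub_one_sub {μ : ℝ} (h4 : -4 < μ) (hμ : μ ≤ 4) :
    chemicalPotentialOfDensity (squareDispersion 1 0)
        (1 - (1 - KohnLuttinger.filling (squareDispersion 1 0) μ)) = μ := by
  rw [sub_sub_cancel]
  exact chemicalPotentialOfDensity_eq_of_filling_eq (kl_wb_filling_pos h4 hμ) ⟨h4.le, hμ⟩ rfl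

/-- For `-4 < μ_b ≤ μ_a ≤ 4` and a hole doping `δ` with `1 - δ ∈ [n(μ_b), n(μ_a)]`, the chemical
potential `μ(1 - δ)` lies in `[μ_b, μ_a]` and realises the density `1 - δ` (intermediate value
theorem for the continuous filling on `[μ_b, μ_a]`). [folklore] -/
theorem kl_wb_window {μa μb δ : ℝ} (h4 : -4 < μb) (hba : μb ≤ μa) (hμa : μa ≤ 4)
    (hδ : 1 - δ ∈ Set.Icc (KohnLuttinger.filling (squareDispersion 1 0) μb)
      (KohnLuttinger.filling (squareDispersion 1 0) μa)) :
    chemicalPotentialOfDensity (squareDispersion 1 0) (1 - δ) ∈ Set.Icc μb μa ∧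
      KohnLuttinger.filling (squareDispersion 1 0)
          (chemicalPotentialOfDensity (squareDispersion 1 0) (1 - δ)) = 1 - δ := by
  obtain ⟨m, hm, hmδ⟩ := intermediate_value_Icc hba continuous_filling.continuousOn hδ
  have hpos : 0 < 1 - δ := (kl_wb_filling_pos h4 (hba.trans hμa)).trans_le hδ.1
  have heq := chemicalPotentialOfDensity_eq_of_filling_eq hpos
    ⟨by linarith [hm.1], hm.2.trans hμa⟩ hmδ
  rw [heq]
  exact ⟨hm, hmδ⟩

/-- **Window bridge.** For `-4 < μ_b < μ_a < 0` put `a = 1 - n(μ_a)`, `b = 1 - n(μ_b)` (`n` = free-band filling,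
strictly increasing and continuous on `[-4,4]`): then `a < b`, `μ(1-a) = μ_a`, `μ(1-b) = μ_b`, and for every
`δ ∈ [a,b]` the chemical potential `μ(1-δ)` lies in `[μ_b, μ_a]` and realises the density `1 - δ`. [folklore] -/
theorem stub_klWindowBridge : ∀ μa μb : ℝ, -4 < μb → μb < μa → μa < 0 →
    1 - KohnLuttinger.filling (squareDispersion 1 0) μa < 1 - KohnLuttinger.filling (squareDispersion 1 0) μb ∧
    chemicalPotentialOfDensity (squareDispersion 1 0)
        (1 - (1 - KohnLuttinger.filling (squareDispersion 1 0) μa)) = μa ∧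
    chemicalPotentialOfDensity (squareDispersion 1 0)
        (1 - (1 - KohnLuttinger.filling (squareDispersion 1 0) μb)) = μb ∧
    ∀ δ ∈ Set.Icc (1 - KohnLuttinger.filling (squareDispersion 1 0) μa)
        (1 - KohnLuttinger.filling (squareDispersion 1 0) μb),
      chemicalPotentialOfDensity (squareDispersion 1 0) (1 - δ) ∈ Set.Icc μb μa ∧
      KohnLuttinger.filling (squareDispersion 1 0) (chemicalPotentialOfDensity (squareDispersion 1 0) (1 - δ)) =
        1 - δ := by
  intro μa μb h4 hba ha0
  have hμa4 : μa ≤ 4 := by linarith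
  have hμb4 : μb ≤ 4 := by linarith
  have hlt : KohnLuttinger.filling (squareDispersion 1 0) μb <
      KohnLuttinger.filling (squareDispersion 1 0) μa :=
    strictMonoOn_filling ⟨h4.le, hμb4⟩ ⟨by linarith, hμa4⟩ hba
  refine ⟨by linarith, kl_wb_chemicalPotential_one_sub_one_sub (by linarith) hμa4,
    kl_wb_chemicalPotential_one_sub_one_sub h4 hμb4, fun δ hδ => ?_⟩
  exact kl_wb_window h4 hba.le hμa4 ⟨by linarith [hδ.2], by linarith [hδ.1]⟩

end Summit.HubbardSuperconductivity.HubbardSuperconductivity.Theorems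

end
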